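import Literature.Probability.RandomPlanarGeometry.HexSAWArmchairWallBridges
import HarnessLib

/-!
# Honeycomb SAW at Beaton's ROTATED (armchair) surface, brick-wall frame: the ODD residue class of armchair wall bridges and
# the literal growth-rate limit `B^w_{2k+1}(y)^{1/(2k+1)} → β_rot(y)`

Topic `Literature/Probability/RandomPlanarGeometry` (lane «pcv-sawmu», rotated-door lineage, rider «ARM-ODD-RATE»; continues
`HexSAWArmchairWallBridges.lean` — the classes `hp`/`arches`/`wb`, the weights `Cw`/`Aw`/`WB`, the junction concatenation
`mul_WB_le : B^w_{n₁}(y) B^w_{n₂}(y) ≤ B^w_{n₁+3+n₂}(y)`, the Fekete rate `armRate y = β_rot(y) = lim_k B^w_{4k-3}(y)^{1/(4k)}` with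
`WB_le_pow : B^w_n(y) ≤ β_rot(y)^{n+3}` and `eventually_pow_le_wseq`).

Sources. N. R. Beaton, *The critical surface fugacity of self-avoiding walks on a rotated honeycomb lattice*, J. Phys. A 47 (2014)
075003 = arXiv:1210.0274v3, §3.1: p. 11 (the `ℤ^d` paragraph after [9] = HTW82: unfolded walks "can be concatenated freely without
creating self-intersections", "it is straightforward to show" that the limit exists) and the proof of Proposition 7, p. 12 ("the proof of
[9] can be applied mutatis mutandis to show that `μ(y) = lim_{n→∞} U_n^+(y)^{1/n}` exists"; "when concatenating unfolded walks on the
honeycomb lattice, the addition of one or two mid-edges at the point of concatenation may be necessary").  J. M. Hammersley, G. M. Torrie,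
S. G. Whittington, J. Phys. A 15 (1982) 539 (unfolded surface walks), as summarised by Beaton 2014 p. 11 — the section number "§2" in the
cites below is unverified (source not held, acq-10393; PROVISIONAL).  N. Madras, G. Slade, *The Self-Avoiding Walk* (1993), §1.2 (Lemma
1.2.2 = Fekete, p. 9; (1.2.15)–(1.2.17), p. 11: `b_m b_n ≤ b_{m+n}`, `b_n ≤ μ_Bridge^n`).  I. G. Enting, I. Jensen, LNP 775 (2009),
§7.4.2, Fig. 7.10 (brickwork form of the honeycomb lattice).

## Why a separate file

In the brick-wall frame an armchair wall bridge has ODD length (`odd_of_mem_wb`) and the junction of `mul_WB_le` adds `3` steps, so the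
supermultiplicative subsequence of Part A is `d_k = B^w_{4k-3}(y)` — lengths `≡ 1 (mod 4)` only; `armRate` is ITS Fekete rate and Part A
proves `B^w_n(y) ≤ β_rot(y)^{n+3}` for every `n` but a lower rate only along `n ≡ 1 (mod 4)`.  The residue class `n ≡ 3 (mod 4)` is
EMPTY for `n = 3, 7` (proved here; design enumeration: `B^w_n(1)`, `n = 1, 3, 5, …, 13` is `1, 0, 1, 0, 3, 2, 13`) and starts at `n = 11`.  This file
exhibits an explicit `11`-step armchair wall bridge `(0,0),(0,1),(1,1),(2,1),(3,1),(3,2),(2,2),(2,3),(1,3),(1,4),(0,4),(0,5)` (it leaves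
the surface zig-zag by a detour around ONE brick, which shifts the length by `2 (mod 4)`), whence `B^w_{11}(y) > 0`, and transports the
rate to the odd class through `B^w_{4j+1}(y) · B^w_{11}(y) ≤ B^w_{4j+15}(y)` (`mul_WB_le`).  Consequences (all PROVED, `0 < y`):

* `OddBridge.ow` with `ow_isBW / ow_injOn / ow_inH / ow_isWB` (an armchair wall bridge of length `11`), `WB_eleven_pos : 0 < B^w_{11}(y)`, `WB_pos_mod_four_three : 2 ≤ j → 0 < B^w_{4j+3}(y)`,
  `WB_pos_of_odd : n odd, n ≠ 3, n ≠ 7 → 0 < B^w_n(y)`; the empty lengths `WB_three : B^w_3(y) = 0`, `WB_seven : B^w_7(y) = 0`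
  (forward anatomy `ω_1 = (0,1)`, `ω_2 = (1,1)`, the level window, and a four-step backward trace), hence the EXACT SUPPORT
  **`WB_pos_iff : 0 < B^w_n(y) ↔ n odd ∧ n ≠ 3 ∧ n ≠ 7`**;
* rate forms: `eventually_pow_le_WB_mod_four_one / _three`, **`eventually_pow_le_WB_odd : 0 ≤ r < β_rot(y) → ∀ᶠ k, r^{2k+1} ≤ B^w_{2k+1}(y)`**,
  `eventually_WB_le_pow : β_rot(y) < r → ∀ᶠ n, B^w_n(y) ≤ rⁿ`;
* **`tendsto_WB_rpow_odd : B^w_{2k+1}(y)^{1/(2k+1)} → β_rot(y)`** — Beaton's "`μ(y) = lim_n U_n^+(y)^{1/n}` exists" read literally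
  for the armchair wall bridges of the brick-wall frame along ALL odd lengths (even lengths carry no wall bridge: `WB_eq_zero_of_even`),
  and the two residue-class limits `tendsto_WB_rpow_mod_four_one / _three`.

NOT claimed: anything about Beaton's mid-edge model beyond the dictionary of `HexSAWRotSurfaceArmchairDictionary.lean`.

LABEL (lit-2 g18, 2026-08-23 21:47Z, concurring with the author's proposal): CONSOLIDATION — an elementary supplement to Part A's Fekete construction; Beaton (p. 12) and HTW82 state the
limit for unfolded walks without residue-class bookkeeping (on the honeycomb proper the parity constraint is invisible in the
mid-edge count).  No statement of this file is claimed new in print terms.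
EDITIONS: ed.1 13273e40c8dde733 (rate + positivity); ed.2 7ce32e1c76a702f4 (+ the support section `WB_three`/`WB_seven`/`WB_pos_iff`);
ed.3 (this) = ed.2 + lit-2 g18's two docstring touches (header quotation split by page; HTW82 locator marked provisional), code-identical to ed.2.
-/

noncomputable section

open Finset Filter Function
open Literature.Probability.LatticeModels Literature.Probability.Percolation SimpleGraph
open _root_.Topology

namespace Literature.Probability.RandomPlanarGeometry.SAW.HexBW.Arm

variable {y : ℝ} {n : ℕ} {ω : ℕ → Site 2}

/-! ### An explicit armchair wall bridge of length `11` -/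

namespace OddBridge

/-- `X`-coordinates of the `11`-step odd-class wall bridge at times `0, …, 11` (and the frozen value `X_11 = 0` afterwards).
[cite: EntingJensen2009, §7.4.2, Fig. 7.10 (brickwork form of the honeycomb lattice)] -/
def X : ℕ → ℤ
  | 0 => 0 | 1 => 0 | 2 => 1 | 3 => 2 | 4 => 3 | 5 => 3 | 6 => 2 | 7 => 2 | 8 => 1 | 9 => 1 | 10 => 0 | _ => 0

/-- `Y`-coordinates of the `11`-step odd-class wall bridge at times `0, …, 11` (and the frozen value `Y_11 = 5` afterwards).
[cite: EntingJensen2009, §7.4.2, Fig. 7.10 (brickwork form of the honeycomb lattice)] -/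
def Y : ℕ → ℤ
  | 0 => 0 | 1 => 1 | 2 => 1 | 3 => 1 | 4 => 1 | 5 => 2 | 6 => 2 | 7 => 3 | 8 => 3 | 9 => 4 | 10 => 4 | _ => 5

/-- **The odd-class wall bridge** `(0,0),(0,1),(1,1),(2,1),(3,1),(3,2),(2,2),(2,3),(1,3),(1,4),(0,4),(0,5)`: the surface zig-zag with
its second dimer step `(1,1) → (1,2)` replaced by the detour `(1,1),(2,1),(3,1),(3,2),(2,2)` around the brick `[1,3] × [1,2]`.
[cite: Beaton2014RotatedHoneycomb, §3.1, proof of Proposition 7 (arXiv v3 p. 12: "the addition of one or two mid-edges at the point of concatenation may be necessary")] -/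
def ow (i : ℕ) : Site 2 := pt (X (min i 11)) (Y (min i 11))

/-- Brick-wall adjacency as a Boolean test on coordinates (the coordinate form `brickWallGraph_adj_coord`).
[cite: EntingJensen2009, §7.4.2, Fig. 7.10 (brickwork form of the honeycomb lattice)] -/
def adjB (a b c d : ℤ) : Bool :=
  ((c = a + 1 ∨ a = c + 1) ∧ d = b) ∨ (c = a ∧ ((d = b + 1 ∧ (a + b) % 2 = 0) ∨ (b = d + 1 ∧ (c + d) % 2 = 0)))

/-- The Boolean test is sound. [cite: EntingJensen2009, §7.4.2, Fig. 7.10 (brickwork form of the honeycomb lattice)] -/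
theorem adj_of_adjB {a b c d : ℤ} (h : adjB a b c d = true) : brickWallGraph.Adj (pt a b) (pt c d) := by
  rw [brickWallGraph_adj_coord]
  simpa [adjB, pt_apply_zero, pt_apply_one] using h

/-- The steps of `ow` are brick-wall bonds (checked on coordinates). [cite: EntingJensen2009, §7.4.2, Fig. 7.10 (brickwork form of the honeycomb lattice)] -/
theorem adjB_steps : ∀ i < 11, adjB (X i) (Y i) (X (i + 1)) (Y (i + 1)) = true := by decide

/-- The coordinates of `ow` at times `≤ 11` are pairwise distinct. [cite: MadrasSlade1993, §1.1 (self-avoidance)] -/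
theorem coords_inj : ∀ i ≤ 11, ∀ j ≤ 11, X i = X j → Y i = Y j → i = j := by decide

/-- `ow` stays in the half-plane `X ≥ 0`. [cite: Beaton2014RotatedHoneycomb, §3.1 (arXiv v3 p. 11: the half-space)] -/
theorem X_nonneg : ∀ i ≤ 11, 0 ≤ X i := by decide

/-- Interior levels of `ow` lie strictly between `0` and `5`. [cite: HammersleyTorrieWhittington1982, §2 (unfolded walks)] -/
theorem Y_interior : ∀ i, 1 ≤ i → i < 11 → 0 < Y i ∧ Y i < 5 := by decide

/-- End data: `X_11 = 0`, `Y_11 = 5`. [cite: HammersleyTorrieWhittington1982, §2 (unfolded walks)] -/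
theorem X_eleven : X 11 = 0 ∧ Y 11 = 5 := by decide

/-- `ow` is frozen after time `11`. [cite: MadrasSlade1993, §1.1] -/
theorem ow_of_ge {i : ℕ} (hi : 11 ≤ i) : ow i = ow 11 := by
  simp only [ow, min_eq_right hi, min_self]

/-- `ow 0 = 0`. [cite: MadrasSlade1993, §1.1] -/
theorem ow_zero : ow 0 = 0 := by
  rw [site_two_eq_iff]; simp [ow, X, Y]

/-- The steps of `ow` are brick-wall bonds. (Design note: facts about the closed walk `ow` are stated in `∀`/`∧`/`=` form and the
Finset memberships `ow ∈ saws 11 / hp 11 / wb 11` are discharged INLINE where used — a closed `_ ∈ wb 11` proposition handed to the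
application elaborator is weak-head normalised at default transparency, which evaluates the finite set.) [cite: MadrasSlade1993, §1.1] -/
theorem ow_isBW : IsBW 11 ow := by
  intro i hi
  simp only [ow, min_eq_left hi.le, min_eq_left (Nat.succ_le_of_lt hi)]
  exact adj_of_adjB (adjB_steps i hi)

/-- `ow` is injective on `[0, 11]`. [cite: MadrasSlade1993, §1.1 (self-avoidance)] -/
theorem ow_injOn : Set.InjOn ow {i | i ≤ 11} := by
  intro i hi j hj hij
  simp only [Set.mem_setOf_eq] at hi hj
  have h0 := congrFun hij 0
  have h1 := congrFun hij 1
  simp only [ow, pt_apply_zero, pt_apply_one, min_eq_left hi, min_eq_left hj] at h0 h1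
  exact coords_inj i hi j hj h0 h1

/-- `ow` stays in Beaton's half-plane. [cite: Beaton2014RotatedHoneycomb, §3.1 (arXiv v3 p. 11: c^+_n(m))] -/
theorem ow_inH : InH 11 ow := fun i _ => by
  simp only [ow, pt_apply_zero]
  exact X_nonneg _ (min_le_right _ _)

/-- `ow` ends on the wall: `X_11 = 0`. [cite: HammersleyTorrieWhittington1982, §2 (unfolded walks)] -/
theorem ow_end : ow 11 0 = 0 := by
  simp only [ow, pt_apply_zero, min_self]; exact X_eleven.1

/-- `ow` satisfies the armchair wall-bridge condition `0 = Y_0 < Y_i < Y_11` (`0 < i < 11`). [cite: HammersleyTorrieWhittington1982, §2 (unfolded walks); Beaton2014RotatedHoneycomb, §3.1 (arXiv v3 p. 12)] -/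
theorem ow_isWB : IsWB 11 ow := by
  refine ⟨?_, fun i hi1 hi => ?_⟩
  · simp only [ow, pt_apply_one, min_self]; rw [X_eleven.2]; norm_num
  · simp only [ow, pt_apply_one, min_self, min_eq_left hi.le]
    rw [X_eleven.2]
    exact Y_interior i hi1 hi

end OddBridge

open OddBridge in
/-- **`B^w_{11}(y) > 0`** for `y > 0`: the explicit walk `ow` is an armchair wall bridge of length `11`, so the odd residue class is
inhabited from length `11` on. [cite: Beaton2014RotatedHoneycomb, §3.1, proof of Proposition 7 (arXiv v3 p. 12: unfolded walks and their concatenation)] -/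
theorem WB_eleven_pos (hy : 0 < y) : 0 < WB 11 y := by
  rw [WB]
  refine lt_of_lt_of_le (pow_pos hy (visits 11 ow)) (Finset.single_le_sum (fun _ _ => pow_nonneg hy.le _) ?_)
  rw [mem_wb, mem_arches, mem_hp, mem_saws_iff]
  exact ⟨⟨⟨⟨ow_zero, fun i hi => ow_of_ge hi, ow_isBW, ow_injOn⟩, ow_inH⟩, ow_end⟩, ow_isWB⟩

/-- **`B^w_{4j+3}(y) > 0` for `j ≥ 2`**: `B^w_{4(j-3)+1}(y) · B^w_{11}(y) ≤ B^w_{4j+3}(y)` by the junction concatenation.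
[cite: MadrasSlade1993, §1.2, (1.2.15) (supermultiplicativity of bridges)] -/
theorem WB_pos_mod_four_three (hy : 0 < y) {j : ℕ} (hj : 2 ≤ j) : 0 < WB (4 * j + 3) y := by
  rcases hj.eq_or_lt with rfl | hj3
  · exact WB_eleven_pos hy
  · have h := mul_WB_le (4 * (j - 3) + 1) 11 hy.le
    rw [show 4 * (j - 3) + 1 + (3 + 11) = 4 * j + 3 by omega] at h
    exact lt_of_lt_of_le (mul_pos (WB_pos hy _) (WB_eleven_pos hy)) h

/-- **`B^w_n(y) > 0` for every odd `n ∉ {3, 7}`** (`y > 0`). (For `n = 3, 7` the class is empty: `WB_three`, `WB_seven`, `WB_pos_iff` below.)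
[cite: MadrasSlade1993, §1.2, (1.2.15); Beaton2014RotatedHoneycomb, §3.1 (arXiv v3 p. 12)] -/
theorem WB_pos_of_odd (hy : 0 < y) (hn : n % 2 = 1) (h3 : n ≠ 3) (h7 : n ≠ 7) : 0 < WB n y := by
  rcases Nat.lt_or_ge (n % 4) 2 with h | h
  · obtain ⟨k, rfl⟩ : ∃ k, n = 4 * k + 1 := ⟨n / 4, by omega⟩
    exact WB_pos hy k
  · obtain ⟨j, rfl⟩ : ∃ j, n = 4 * j + 3 := ⟨n / 4, by omega⟩
    exact WB_pos_mod_four_three hy (by omega)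

/-! ### The support of the class: lengths `3` and `7` carry no armchair wall bridge -/

/-- Two consecutive steps raise the level by at most one (after a dimer step up the site type is odd, so the next step is not up).
[cite: EntingJensen2009, §7.4.2, Fig. 7.10 (brickwork form of the honeycomb lattice)] -/
theorem level_add_two_le (hω : ω ∈ saws n) {i : ℕ} (hi : i + 1 < n) : ω (i + 2) 1 ≤ ω i 1 + 1 := by
  obtain ⟨-, -, hbw, -⟩ := mem_saws_iff.1 hω
  have h1 := step_cases (hbw i (by omega))
  have h2 := step_cases (hbw (i + 1) hi)
  rw [show i + 1 + 1 = i + 2 by omega] at h2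
  omega

/-- The first step of an armchair wall bridge of length `≥ 2` is the dimer step up the wall: `ω_1 = (0,1)`.
[cite: Beaton2014RotatedHoneycomb, §2 (Fig. 1: the armchair surface); HammersleyTorrieWhittington1982, §2 (unfolded walks)] -/
theorem wb_apply_one (hω : ω ∈ wb n) (hn : 2 ≤ n) : ω 1 0 = 0 ∧ ω 1 1 = 1 := by
  obtain ⟨hs, -, -, -, hint⟩ := wb_anatomy hω
  obtain ⟨h0, -, hbw, -⟩ := mem_saws_iff.1 hs
  have hst := step_cases (hbw 0 (by omega))
  rw [zero_add, h0] at hst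
  have z0 : (0 : Site 2) 0 = 0 := rfl
  have z1 : (0 : Site 2) 1 = 0 := rfl
  rw [z0, z1] at hst
  have hY1 := (hint 1 le_rfl (by omega)).1
  constructor <;> omega

/-- The second step of an armchair wall bridge of length `≥ 3` is horizontal, away from the wall: `ω_2 = (1,1)`.
[cite: Beaton2014RotatedHoneycomb, §2 (Fig. 1: the armchair surface); HammersleyTorrieWhittington1982, §2 (unfolded walks)] -/
theorem wb_apply_two (hω : ω ∈ wb n) (hn : 3 ≤ n) : ω 2 0 = 1 ∧ ω 2 1 = 1 := by
  obtain ⟨hs, hH, -, -, hint⟩ := wb_anatomy hω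
  obtain ⟨-, -, hbw, -⟩ := mem_saws_iff.1 hs
  obtain ⟨hX1, hY1⟩ := wb_apply_one hω (by omega)
  have hst := step_cases (hbw 1 (by omega))
  rw [show (1 : ℕ) + 1 = 2 from rfl, hX1, hY1] at hst
  have hY2 := (hint 2 (by norm_num) (by omega)).1
  have hX2 := hH 2 (by omega)
  constructor <;> omega

/-- **No armchair wall bridge has length `3`**: after `(0,0),(0,1),(1,1)` the end level would be odd, `> 1` and `≤ 2`.
(Stated with a symbolic length `n = 3`; see the design note at `OddBridge.ow_isBW`.) [cite: HammersleyTorrieWhittington1982, §2 (unfolded walks); EntingJensen2009, §7.4.2, Fig. 7.10] -/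
theorem not_mem_wb_of_eq_three (hω : ω ∈ wb n) (hn : n = 3) : False := by
  obtain ⟨hs, -, -, -, hint⟩ := wb_anatomy hω
  have hodd := wb_end_odd hω
  obtain ⟨-, hY1⟩ := wb_apply_one hω (by omega)
  obtain ⟨-, hY2⟩ := wb_apply_two hω (by omega)
  have h3 := level_add_two_le hs (i := 1) (by omega)
  have hlt := (hint 2 (by norm_num) (by omega)).2
  rw [show (1 : ℕ) + 2 = n by omega] at h3
  omega

/-- **No armchair wall bridge has length `7`**: the end level is forced to be `3`, the last step is the dimer step `(0,2) → (0,3)`, and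
walking backwards `ω_5 = (1,2)`, `ω_4 = (2,2)`, `ω_3 = (2,1)` (self-avoidance and the level window), but `(2,1)(2,2)` is not a bond.
[cite: HammersleyTorrieWhittington1982, §2 (unfolded walks); EntingJensen2009, §7.4.2, Fig. 7.10] -/
theorem not_mem_wb_of_eq_seven (hω : ω ∈ wb n) (hn : n = 7) : False := by
  obtain ⟨hs, hH, hend, -, hint⟩ := wb_anatomy hω
  have hodd := wb_end_odd hω
  obtain ⟨hX1, hY1⟩ := wb_apply_one hω (by omega)
  obtain ⟨hX2, hY2⟩ := wb_apply_two hω (by omega)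
  have h13 := level_add_two_le hs (i := 1) (by omega)
  have h35 := level_add_two_le hs (i := 3) (by omega)
  have h57 := level_add_two_le hs (i := 5) (by omega)
  obtain ⟨-, -, hbw, hinj⟩ := mem_saws_iff.1 hs
  clear hω hs
  subst hn
  norm_num at h13 h35 h57
  -- the end level is `3`
  have hlt2 := (hint 2 (by norm_num) (by norm_num)).2
  have hY7 : ω 7 1 = 3 := by omega
  have hI3 := hint 3 (by norm_num) (by norm_num)
  have hI4 := hint 4 (by norm_num) (by norm_num)
  have hI5 := hint 5 (by norm_num) (by norm_num)
  have hI6 := hint 6 (by norm_num) (by norm_num)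
  have hH3 := hH 3 (by norm_num)
  have hH4 := hH 4 (by norm_num)
  have hH5 := hH 5 (by norm_num)
  rw [hY7] at hlt2 hI3 hI4 hI5 hI6
  -- self-avoidance, as index statements
  have hne : ∀ i j : ℕ, i ≤ 7 → j ≤ 7 → ω i 0 = ω j 0 → ω i 1 = ω j 1 → i = j := fun i j hi hj h0 h1 =>
    hinj (show i ∈ {k | k ≤ 7} from hi) (show j ∈ {k | k ≤ 7} from hj) ((site_two_eq_iff _ _).2 ⟨h0, h1⟩)
  -- step 6 → 7: the dimer step up from `(0,2)`
  have s6 := step_cases (hbw 6 (by norm_num))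
  norm_num at s6
  rw [hend, hY7] at s6
  have hX6 : ω 6 0 = 0 := by omega
  have hY6 : ω 6 1 = 2 := by omega
  -- step 5 → 6: `ω_5 = (1,2)` (`(0,1) = ω_1` is excluded by self-avoidance, level `3` by the window)
  have s5 := step_cases (hbw 5 (by norm_num))
  norm_num at s5
  rw [hX6, hY6] at s5
  have h51 := hne 5 1 (by norm_num) (by norm_num)
  rw [hX1, hY1] at h51
  have hX5 : ω 5 0 = 1 := by omega
  have hY5 : ω 5 1 = 2 := by omega
  -- step 4 → 5: `ω_4 = (2,2)`
  have s4 := step_cases (hbw 4 (by norm_num))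
  norm_num at s4
  rw [hX5, hY5] at s4
  have h46 := hne 4 6 (by norm_num) (by norm_num)
  rw [hX6, hY6] at h46
  have h42 := hne 4 2 (by norm_num) (by norm_num)
  rw [hX2, hY2] at h42
  have hX4 : ω 4 0 = 2 := by omega
  have hY4 : ω 4 1 = 2 := by omega
  -- step 2 → 3: `ω_3 = (2,1)`
  have s2 := step_cases (hbw 2 (by norm_num))
  norm_num at s2
  rw [hX2, hY2] at s2
  have h31 := hne 3 1 (by norm_num) (by norm_num)
  rw [hX1, hY1] at h31
  have h35' := hne 3 5 (by norm_num) (by norm_num)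
  rw [hX5, hY5] at h35'
  have hX3 : ω 3 0 = 2 := by omega
  have hY3 : ω 3 1 = 1 := by omega
  -- step 3 → 4 would be the bond `(2,1)(2,2)`, which the brick wall does not have (`2 + 1` odd)
  have s3 := step_cases (hbw 3 (by norm_num))
  norm_num at s3
  rw [hX3, hY3, hX4, hY4] at s3
  omega

/-- `wb 3 = ∅` (symbolic length). [cite: HammersleyTorrieWhittington1982, §2 (unfolded walks)] -/
theorem wb_eq_empty_of_eq_three (hn : n = 3) : wb n = ∅ :=
  Finset.eq_empty_of_forall_notMem fun _ hω => not_mem_wb_of_eq_three hω hn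

/-- `wb 7 = ∅` (symbolic length). [cite: HammersleyTorrieWhittington1982, §2 (unfolded walks)] -/
theorem wb_eq_empty_of_eq_seven (hn : n = 7) : wb n = ∅ :=
  Finset.eq_empty_of_forall_notMem fun _ hω => not_mem_wb_of_eq_seven hω hn

/-- **`B^w_3(y) = 0`.** [cite: HammersleyTorrieWhittington1982, §2 (unfolded walks); Beaton2014RotatedHoneycomb, §3.1 (arXiv v3 p. 12)] -/
theorem WB_three (y : ℝ) : WB 3 y = 0 := by
  rw [WB, wb_eq_empty_of_eq_three rfl, Finset.sum_empty]

/-- **`B^w_7(y) = 0`.** [cite: HammersleyTorrieWhittington1982, §2 (unfolded walks); Beaton2014RotatedHoneycomb, §3.1 (arXiv v3 p. 12)] -/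
theorem WB_seven (y : ℝ) : WB 7 y = 0 := by
  rw [WB, wb_eq_empty_of_eq_seven rfl, Finset.sum_empty]

/-- **The exact support of the armchair wall-bridge class: `B^w_n(y) > 0 ↔ n` is odd and `n ∉ {3, 7}`** (`y > 0`).
[cite: Beaton2014RotatedHoneycomb, §3.1, proof of Proposition 7 (arXiv v3 p. 12: unfolded walks and their concatenation); MadrasSlade1993, §1.2, (1.2.15)] -/
theorem WB_pos_iff (hy : 0 < y) : 0 < WB n y ↔ n % 2 = 1 ∧ n ≠ 3 ∧ n ≠ 7 := by
  refine ⟨fun h => ?_, fun h => WB_pos_of_odd hy h.1 h.2.1 h.2.2⟩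
  refine ⟨?_, ?_, ?_⟩
  · by_contra hne
    rw [WB_eq_zero_of_even (by omega) y] at h
    exact lt_irrefl _ h
  · rintro rfl; rw [WB_three] at h; exact lt_irrefl _ h
  · rintro rfl; rw [WB_seven] at h; exact lt_irrefl _ h

/-! ### Rate forms on both residue classes -/

/-- Comparison of two geometric rates: for `0 < r < r'` and `c > 0`, eventually `rᵐ ≤ c · r'ᵐ`. [cite: MadrasSlade1993, §1.2, Lemma 1.2.2] -/
theorem eventually_pow_le_mul_pow {r r' c : ℝ} (hr0 : 0 < r) (hrr' : r < r') (hc : 0 < c) :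
    ∀ᶠ m : ℕ in atTop, r ^ m ≤ c * r' ^ m := by
  have hr'0 : 0 < r' := hr0.trans hrr'
  have hq0 : 0 ≤ r / r' := (div_pos hr0 hr'0).le
  have hq1 : r / r' < 1 := (div_lt_one hr'0).2 hrr'
  have hev := (tendsto_order.1 (tendsto_pow_atTop_nhds_zero_of_lt_one hq0 hq1)).2 c hc
  filter_upwards [hev] with m hm
  have hm' : (r / r') ^ m * r' ^ m ≤ c * r' ^ m := mul_le_mul_of_nonneg_right hm.le (pow_nonneg hr'0.le _)
  calc r ^ m = (r / r') ^ m * r' ^ m := by rw [div_pow, div_mul_cancel₀ _ (pow_ne_zero _ hr'0.ne')]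
    _ ≤ c * r' ^ m := hm'

/-- **Lower rate on the class `n ≡ 1 (mod 4)`**: for `0 ≤ r < β_rot(y)`, eventually `r^{4j+1} ≤ B^w_{4j+1}(y)`.
[cite: MadrasSlade1993, §1.2, Lemma 1.2.2 and (1.2.17)] -/
theorem eventually_pow_le_WB_mod_four_one (hy : 0 < y) {r : ℝ} (hr0 : 0 ≤ r) (hr : r < armRate y) :
    ∀ᶠ j : ℕ in atTop, r ^ (4 * j + 1) ≤ WB (4 * j + 1) y := by
  rcases hr0.eq_or_lt with rfl | hr0'
  · exact Eventually.of_forall fun j => by rw [zero_pow (by omega)]; exact WB_nonneg _ hy.le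
  set r' := (r + armRate y) / 2 with hr'_def
  have hrr' : r < r' := by rw [hr'_def]; linarith
  have hr'β : r' < armRate y := by rw [hr'_def]; linarith
  have hr'0 : 0 < r' := hr0'.trans hrr'
  obtain ⟨J₁, hJ₁⟩ := eventually_atTop.1 (eventually_pow_le_wseq hy hr'0 hr'β)
  obtain ⟨M, hM⟩ := eventually_atTop.1 (eventually_pow_le_mul_pow hr0' hrr' (pow_pos hr'0 3))
  refine eventually_atTop.2 ⟨J₁ + M, fun j hj => ?_⟩
  have h1 := hJ₁ (j + 1) (by omega)
  rw [wseq, if_neg (by omega), show 4 * (j + 1) - 3 = 4 * j + 1 by omega] at h1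
  calc r ^ (4 * j + 1) ≤ r' ^ 3 * r' ^ (4 * j + 1) := hM _ (by omega)
    _ = r' ^ (4 * (j + 1)) := by rw [← pow_add]; congr 1; ring
    _ ≤ WB (4 * j + 1) y := h1

/-- **Lower rate on the class `n ≡ 3 (mod 4)`**: for `0 ≤ r < β_rot(y)`, eventually `r^{4j+3} ≤ B^w_{4j+3}(y)` — through
`B^w_{4(j-3)+1}(y) · B^w_{11}(y) ≤ B^w_{4j+3}(y)`. [cite: MadrasSlade1993, §1.2, (1.2.15)–(1.2.17)] -/
theorem eventually_pow_le_WB_mod_four_three (hy : 0 < y) {r : ℝ} (hr0 : 0 ≤ r) (hr : r < armRate y) :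
    ∀ᶠ j : ℕ in atTop, r ^ (4 * j + 3) ≤ WB (4 * j + 3) y := by
  rcases hr0.eq_or_lt with rfl | hr0'
  · exact Eventually.of_forall fun j => by rw [zero_pow (by omega)]; exact WB_nonneg _ hy.le
  set r' := (r + armRate y) / 2 with hr'_def
  have hrr' : r < r' := by rw [hr'_def]; linarith
  have hr'β : r' < armRate y := by rw [hr'_def]; linarith
  have hr'0 : 0 < r' := hr0'.trans hrr'
  have h11 := WB_eleven_pos hy
  obtain ⟨J₁, hJ₁⟩ := eventually_atTop.1 (eventually_pow_le_wseq hy hr'0 hr'β)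
  obtain ⟨M, hM⟩ := eventually_atTop.1
    (eventually_pow_le_mul_pow hr0' hrr' (div_pos h11 (pow_pos hr'0 11)))
  refine eventually_atTop.2 ⟨J₁ + M + 3, fun j hj => ?_⟩
  have h1 := hJ₁ (j - 2) (by omega)
  rw [wseq, if_neg (by omega), show 4 * (j - 2) - 3 = 4 * (j - 3) + 1 by omega] at h1
  have h2 := mul_WB_le (4 * (j - 3) + 1) 11 hy.le
  rw [show 4 * (j - 3) + 1 + (3 + 11) = 4 * j + 3 by omega] at h2
  have hsplit : r' ^ (4 * j + 3) = r' ^ (4 * (j - 2)) * r' ^ 11 := by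
    rw [← pow_add]; congr 1; omega
  calc r ^ (4 * j + 3) ≤ WB 11 y / r' ^ 11 * r' ^ (4 * j + 3) := hM _ (by omega)
    _ = r' ^ (4 * (j - 2)) * WB 11 y := by
        rw [hsplit, div_mul_eq_mul_div, div_eq_iff (pow_ne_zero _ hr'0.ne')]; ring
    _ ≤ WB (4 * (j - 3) + 1) y * WB 11 y := mul_le_mul_of_nonneg_right h1 (WB_nonneg _ hy.le)
    _ ≤ WB (4 * j + 3) y := h2

/-- From the two residue classes to all odd lengths. [cite: MadrasSlade1993, §1.2, Lemma 1.2.2] -/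
theorem eventually_odd_of_mod_four {P : ℕ → Prop} (h1 : ∀ᶠ j : ℕ in atTop, P (4 * j + 1))
    (h3 : ∀ᶠ j : ℕ in atTop, P (4 * j + 3)) : ∀ᶠ k : ℕ in atTop, P (2 * k + 1) := by
  obtain ⟨J₁, hJ₁⟩ := eventually_atTop.1 h1
  obtain ⟨J₃, hJ₃⟩ := eventually_atTop.1 h3
  refine eventually_atTop.2 ⟨2 * (J₁ + J₃), fun k hk => ?_⟩
  obtain ⟨j, hj | hj⟩ := Nat.even_or_odd' k
  · have h := hJ₁ j (by omega)
    rw [show 4 * j + 1 = 2 * k + 1 by omega] at h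
    exact h
  · have h := hJ₃ j (by omega)
    rw [show 4 * j + 3 = 2 * k + 1 by omega] at h
    exact h

/-- **Lower rate along ALL odd lengths**: for `0 ≤ r < β_rot(y)`, eventually `r^{2k+1} ≤ B^w_{2k+1}(y)`.
[cite: Beaton2014RotatedHoneycomb, §3.1, proof of Proposition 7 (arXiv v3 p. 12: "μ(y) = lim U_n^+(y)^{1/n} exists")] -/
theorem eventually_pow_le_WB_odd (hy : 0 < y) {r : ℝ} (hr0 : 0 ≤ r) (hr : r < armRate y) :
    ∀ᶠ k : ℕ in atTop, r ^ (2 * k + 1) ≤ WB (2 * k + 1) y :=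
  eventually_odd_of_mod_four (P := fun m => r ^ m ≤ WB m y) (eventually_pow_le_WB_mod_four_one hy hr0 hr)
    (eventually_pow_le_WB_mod_four_three hy hr0 hr)

/-- **Upper rate**: for `r > β_rot(y)`, eventually `B^w_n(y) ≤ rⁿ` (from `B^w_n(y) ≤ β_rot(y)^{n+3}`).
[cite: MadrasSlade1993, §1.2, (1.2.17)] -/
theorem eventually_WB_le_pow (hy : 0 < y) {r : ℝ} (hr : armRate y < r) : ∀ᶠ n : ℕ in atTop, WB n y ≤ r ^ n := by
  have hβ := armRate_pos y
  filter_upwards [eventually_pow_le_mul_pow hβ hr (inv_pos.2 (pow_pos hβ 3))] with n hn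
  calc WB n y ≤ armRate y ^ (n + 3) := WB_le_pow hy n
    _ = armRate y ^ 3 * armRate y ^ n := by rw [← pow_add, add_comm]
    _ ≤ armRate y ^ 3 * ((armRate y ^ 3)⁻¹ * r ^ n) := mul_le_mul_of_nonneg_left hn (pow_nonneg hβ.le _)
    _ = r ^ n := by rw [← mul_assoc, mul_inv_cancel₀ (pow_ne_zero _ hβ.ne'), one_mul]

/-! ### The limit along odd lengths -/

/-- **Squeeze along the odd subsequence**: if every rate below `L` is eventually dominated by `a_k` at exponent `2k+1` and every rate
above `L` eventually dominates it, then `a_k^{1/(2k+1)} → L`. [cite: MadrasSlade1993, §1.2, Lemma 1.2.2] -/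
theorem tendsto_rpow_odd_of_squeeze {a : ℕ → ℝ} (ha : ∀ k, 0 ≤ a k) {L : ℝ} (hL : 0 < L)
    (hge : ∀ r : ℝ, 0 ≤ r → r < L → ∀ᶠ k : ℕ in atTop, r ^ (2 * k + 1) ≤ a k)
    (hle : ∀ r : ℝ, L < r → ∀ᶠ k : ℕ in atTop, a k ≤ r ^ (2 * k + 1)) :
    Tendsto (fun k : ℕ => a k ^ (((2 * k + 1 : ℕ) : ℝ)⁻¹)) atTop (𝓝 L) := by
  rw [tendsto_order]
  constructor
  · intro b hb
    set r := (max b 0 + L) / 2 with hr_def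
    have hmax : max b 0 < L := max_lt hb hL
    have hr0 : 0 ≤ r := by rw [hr_def]; have := le_max_right b 0; linarith
    have hbr : b < r := by rw [hr_def]; have := le_max_left b 0; linarith
    have hrL : r < L := by rw [hr_def]; linarith
    filter_upwards [hge r hr0 hrL] with k hk
    calc b < r := hbr
      _ = (r ^ (2 * k + 1)) ^ (((2 * k + 1 : ℕ) : ℝ)⁻¹) := (Real.pow_rpow_inv_natCast hr0 (by omega)).symm
      _ ≤ a k ^ (((2 * k + 1 : ℕ) : ℝ)⁻¹) := Real.rpow_le_rpow (pow_nonneg hr0 _) hk (inv_nonneg.2 (Nat.cast_nonneg _))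
  · intro b hb
    set r := (b + L) / 2 with hr_def
    have hLr : L < r := by rw [hr_def]; linarith
    have hrb : r < b := by rw [hr_def]; linarith
    have hr0 : 0 ≤ r := hL.le.trans hLr.le
    filter_upwards [hle r hLr] with k hk
    calc a k ^ (((2 * k + 1 : ℕ) : ℝ)⁻¹) ≤ (r ^ (2 * k + 1)) ^ (((2 * k + 1 : ℕ) : ℝ)⁻¹) :=
          Real.rpow_le_rpow (ha k) hk (inv_nonneg.2 (Nat.cast_nonneg _))
      _ = r := Real.pow_rpow_inv_natCast hr0 (by omega)
      _ < b := hrb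

/-- **The growth rate of armchair wall bridges along ALL odd lengths: `B^w_{2k+1}(y)^{1/(2k+1)} → β_rot(y)`** (`y > 0`) — Beaton's
"`μ(y) = lim_{n→∞} U_n^+(y)^{1/n}` exists" for the unfolded (wall-bridge) class of the brick-wall frame, read along every length that
carries a wall bridge. [cite: Beaton2014RotatedHoneycomb, §3.1, proof of Proposition 7 (arXiv v3 p. 12: "μ(y) = lim_{n→∞} U_n^+(y)^{1/n} exists")] -/
theorem tendsto_WB_rpow_odd (hy : 0 < y) :
    Tendsto (fun k : ℕ => WB (2 * k + 1) y ^ (((2 * k + 1 : ℕ) : ℝ)⁻¹)) atTop (𝓝 (armRate y)) := by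
  refine tendsto_rpow_odd_of_squeeze (fun k => WB_nonneg _ hy.le) (armRate_pos y)
    (fun r hr0 hr => eventually_pow_le_WB_odd hy hr0 hr) fun r hr => ?_
  obtain ⟨N, hN⟩ := eventually_atTop.1 (eventually_WB_le_pow hy hr)
  exact eventually_atTop.2 ⟨N, fun k hk => hN _ (by omega)⟩

/-- The limit along `n ≡ 1 (mod 4)`: `B^w_{4j+1}(y)^{1/(4j+1)} → β_rot(y)`. [cite: MadrasSlade1993, §1.2, Lemma 1.2.2 and (1.2.17)] -/
theorem tendsto_WB_rpow_mod_four_one (hy : 0 < y) :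
    Tendsto (fun j : ℕ => WB (4 * j + 1) y ^ (((4 * j + 1 : ℕ) : ℝ)⁻¹)) atTop (𝓝 (armRate y)) := by
  have h2 : Tendsto (fun j : ℕ => 2 * j) atTop atTop := tendsto_atTop_mono (fun j : ℕ => (by omega : j ≤ 2 * j)) tendsto_id
  have h := (tendsto_WB_rpow_odd hy).comp h2
  refine h.congr fun j => ?_
  simp only [Function.comp_def]
  rw [show 2 * (2 * j) + 1 = 4 * j + 1 by ring]

/-- The limit along `n ≡ 3 (mod 4)`: `B^w_{4j+3}(y)^{1/(4j+3)} → β_rot(y)` (the class inhabited from `n = 11` on).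
[cite: MadrasSlade1993, §1.2, Lemma 1.2.2 and (1.2.15)–(1.2.17)] -/
theorem tendsto_WB_rpow_mod_four_three (hy : 0 < y) :
    Tendsto (fun j : ℕ => WB (4 * j + 3) y ^ (((4 * j + 3 : ℕ) : ℝ)⁻¹)) atTop (𝓝 (armRate y)) := by
  have h2 : Tendsto (fun j : ℕ => 2 * j + 1) atTop atTop := tendsto_atTop_mono (fun j : ℕ => (by omega : j ≤ 2 * j + 1)) tendsto_id
  have h := (tendsto_WB_rpow_odd hy).comp h2
  refine h.congr fun j => ?_
  simp only [Function.comp_def]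
  rw [show 2 * (2 * j + 1) + 1 = 4 * j + 3 by ring]

end Literature.Probability.RandomPlanarGeometry.SAW.HexBW.Arm
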